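import Mathlib.Analysis.Real.Sqrt
import Mathlib.Tactic.LinearCombination
import Mathlib.Tactic.Positivity
import Mathlib.Tactic.Linarith

/-!
# Exact arithmetic in `ℚ(√(2+√2))` with a certified sign test (certificate layer of the peeled LP)

Helper file for the crux `NoFoldBound` (stmt-CriticalPhenomena-8296) of the route `SAWDevelopingMap`
(sub-problem `SAWScalingLimit` of `CriticalPhenomena`), programme FLAT / PEELED LP of the lead seats
c9–c10 (`FLAT-FINITE.md`, `FLAT-LEAN-DESIGN.md` on the item), brick L4(a). All coefficients of the
peeled linear programme — the critical fugacity `x_c = 1/t`, the phases `e^{i·3W/8}` (`3W/8 ∈ 22.5°·ℤ`)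
and the dual multipliers (rationals) — live in the number field `ℚ(t)`, `t = √(2+√2) = 2cos(π/8)`,
`t⁴ = 4t² − 2`. To check the 1217 reduced costs of the certificate INSIDE THE KERNEL (by `decide`, no
`native_decide`) we reflect this arithmetic:

* `QT` — quadruples of rationals `a + b t + c t² + d t³` with `+, −, ·` (product reduced by
  `t⁴ = 4t² − 2`), `QT.eval τ` — the real value at a real `τ`, and the ring-homomorphism lemmas
  `eval_add/neg/sub/mul` (the last under `τ⁴ = 4τ² − 2`);
* `QT.lb lo hi` — a rational LOWER BOUND of the value on `τ ∈ [lo, hi]`, `0 ≤ lo` (monomial by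
  monomial, by the sign of the coefficient), with `lb_le_eval`;
* `QT.dot` — `Σ qᵢ · xᵢ` over a list (a sparse column of the constraint matrix against the
  multipliers), `eval_dot`; `QT.colOK lo hi terms c` — the Boolean test "`lb (dot terms − c) ≥ 0`" and
  its soundness `le_eval_dot_of_colOK` : the reduced cost `Σ uₑ Aₑⱼ − cⱼ` is `≥ 0` at `τ`;
* `tau_bounds` — `1.847759065022 ≤ √(2+√2) ≤ 1.847759065023` and `sqrt_two_add_sqrt_two_pow_four`.
-/

/-- An element `a + b t + c t² + d t³` of `ℚ(t)`, `t⁴ = 4t² − 2`, by its coordinates. -/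
structure QT where
  /-- coefficient of `1` -/
  a : ℚ
  /-- coefficient of `t` -/
  b : ℚ
  /-- coefficient of `t²` -/
  c : ℚ
  /-- coefficient of `t³` -/
  d : ℚ
  deriving DecidableEq, Repr

namespace QT

/-- Coordinatewise sum. -/
def add (x y : QT) : QT := ⟨x.a + y.a, x.b + y.b, x.c + y.c, x.d + y.d⟩
/-- Coordinatewise negation. -/
def neg (x : QT) : QT := ⟨-x.a, -x.b, -x.c, -x.d⟩
/-- Coordinatewise difference. -/
def sub (x y : QT) : QT := ⟨x.a - y.a, x.b - y.b, x.c - y.c, x.d - y.d⟩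
/-- Scalar multiple by a rational. -/
def smul (q : ℚ) (x : QT) : QT := ⟨q * x.a, q * x.b, q * x.c, q * x.d⟩
/-- Product, reduced by `t⁴ = 4t² − 2`, `t⁵ = 4t³ − 2t`, `t⁶ = 14t² − 8`. -/
def mul (x y : QT) : QT :=
  let e4 := x.b * y.d + x.c * y.c + x.d * y.b
  let e5 := x.c * y.d + x.d * y.c
  let e6 := x.d * y.d
  ⟨x.a * y.a - 2 * e4 - 8 * e6,
   x.a * y.b + x.b * y.a - 2 * e5,
   x.a * y.c + x.b * y.b + x.c * y.a + 4 * e4 + 14 * e6,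
   x.a * y.d + x.b * y.c + x.c * y.b + x.d * y.a + 4 * e5⟩
/-- Zero. -/
def zero : QT := ⟨0, 0, 0, 0⟩

/-- `+` on `QT`. -/
instance : Add QT := ⟨add⟩
/-- unary `−` on `QT`. -/
instance : Neg QT := ⟨neg⟩
/-- binary `−` on `QT`. -/
instance : Sub QT := ⟨sub⟩
/-- `·` on `QT` (reduced product). -/
instance : Mul QT := ⟨mul⟩
/-- `0 : QT`. -/
instance : Zero QT := ⟨zero⟩

/-- The real value of `a + b τ + c τ² + d τ³`. -/
def eval (τ : ℝ) (x : QT) : ℝ := x.a + x.b * τ + x.c * τ ^ 2 + x.d * τ ^ 3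

/-- `eval` on a quadruple. -/
@[simp] theorem eval_mk (τ : ℝ) (a b c d : ℚ) :
    eval τ ⟨a, b, c, d⟩ = a + b * τ + c * τ ^ 2 + d * τ ^ 3 := rfl

/-- `eval 0 = 0`. -/
theorem eval_zero (τ : ℝ) : eval τ 0 = 0 := by
  show eval τ ⟨0, 0, 0, 0⟩ = 0; simp

/-- `eval` is additive. -/
theorem eval_add (τ : ℝ) (x y : QT) : eval τ (x + y) = eval τ x + eval τ y := by
  show eval τ (add x y) = _; simp only [add, eval]; push_cast; ring

/-- `eval` commutes with negation. -/
theorem eval_neg (τ : ℝ) (x : QT) : eval τ (-x) = -eval τ x := by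
  show eval τ (neg x) = _; simp only [neg, eval]; push_cast; ring

/-- `eval` commutes with subtraction. -/
theorem eval_sub (τ : ℝ) (x y : QT) : eval τ (x - y) = eval τ x - eval τ y := by
  show eval τ (sub x y) = _; simp only [sub, eval]; push_cast; ring

/-- `eval` commutes with rational scaling. -/
theorem eval_smul (τ : ℝ) (q : ℚ) (x : QT) : eval τ (smul q x) = q * eval τ x := by
  simp only [smul, eval]; push_cast; ring

/-- The product is multiplicative at every root of `τ⁴ = 4τ² − 2`. -/
theorem eval_mul {τ : ℝ} (hτ : τ ^ 4 = 4 * τ ^ 2 - 2) (x y : QT) :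
    eval τ (x * y) = eval τ x * eval τ y := by
  show eval τ (mul x y) = _
  simp only [mul, eval]
  push_cast
  linear_combination (-(x.b * y.d + x.c * y.c + x.d * y.b : ℝ) - (x.c * y.d + x.d * y.c : ℝ) * τ
    - (x.d * y.d : ℝ) * τ ^ 2 - 4 * (x.d * y.d : ℝ)) * hτ

/-! ### The interval sign test -/

/-- A rational lower bound of `eval τ x` for `τ ∈ [lo, hi]`, `0 ≤ lo`: each monomial is bounded
below using the sign of its coefficient. -/
def lb (lo hi : ℚ) (x : QT) : ℚ :=
  x.a + (max x.b 0 * lo + min x.b 0 * hi) + (max x.c 0 * lo ^ 2 + min x.c 0 * hi ^ 2) +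
    (max x.d 0 * lo ^ 3 + min x.d 0 * hi ^ 3)

/-- One monomial: `max q 0 · loᵏ + min q 0 · hiᵏ ≤ q · τᵏ` for `loᵏ ≤ τᵏ ≤ hiᵏ`. -/
theorem mono_lb {q : ℚ} {L H T : ℝ} (h1 : L ≤ T) (h2 : T ≤ H) :
    ((max q 0 : ℚ) : ℝ) * L + ((min q 0 : ℚ) : ℝ) * H ≤ (q : ℝ) * T := by
  rcases le_total 0 q with hq | hq
  · rw [max_eq_left hq, min_eq_right hq]; push_cast
    nlinarith [mul_le_mul_of_nonneg_left h1 (show (0:ℝ) ≤ q by exact_mod_cast hq)]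
  · rw [max_eq_right hq, min_eq_left hq]; push_cast
    nlinarith [mul_le_mul_of_nonpos_left h2 (show (q:ℝ) ≤ 0 by exact_mod_cast hq)]

/-- **Soundness of the lower bound.** -/
theorem lb_le_eval {lo hi : ℚ} {τ : ℝ} (h0 : 0 ≤ lo) (h1 : (lo : ℝ) ≤ τ) (h2 : τ ≤ hi) (x : QT) :
    (lb lo hi x : ℝ) ≤ eval τ x := by
  have hL : (0 : ℝ) ≤ lo := by exact_mod_cast h0
  have hT : 0 ≤ τ := hL.trans h1
  have e1 := mono_lb (q := x.b) h1 h2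
  have e2 := mono_lb (q := x.c) (pow_le_pow_left₀ hL h1 2) (pow_le_pow_left₀ hT h2 2)
  have e3 := mono_lb (q := x.d) (pow_le_pow_left₀ hL h1 3) (pow_le_pow_left₀ hT h2 3)
  simp only [lb, eval]
  push_cast at e1 e2 e3 ⊢
  linarith

/-! ### Sparse columns against rational multipliers -/

/-- `Σᵢ qᵢ · xᵢ` over a list of (multiplier, coefficient) pairs. -/
def dot : List (ℚ × QT) → QT
  | [] => 0
  | (q, x) :: l => smul q x + dot l

/-- `eval` of a sparse dot product is the real dot product. -/
theorem eval_dot (τ : ℝ) : ∀ l : List (ℚ × QT),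
    eval τ (dot l) = (l.map fun p => (p.1 : ℝ) * eval τ p.2).sum
  | [] => by simp [dot, eval_zero]
  | (q, x) :: l => by rw [dot, eval_add, eval_smul, eval_dot τ l, List.map_cons, List.sum_cons]

/-- The column test: the reduced cost `dot terms − c` has a nonnegative certified lower bound. -/
def colOK (lo hi : ℚ) (terms : List (ℚ × QT)) (c : QT) : Bool :=
  decide (0 ≤ lb lo hi (dot terms - c))

/-- **Soundness of the column test**: `c ≤ Σᵢ qᵢ·xᵢ` at `τ`. -/
theorem le_eval_dot_of_colOK {lo hi : ℚ} {τ : ℝ} (h0 : 0 ≤ lo) (h1 : (lo : ℝ) ≤ τ) (h2 : τ ≤ hi)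
    {terms : List (ℚ × QT)} {c : QT} (h : colOK lo hi terms c = true) :
    eval τ c ≤ (terms.map fun p => (p.1 : ℝ) * eval τ p.2).sum := by
  have hb : 0 ≤ lb lo hi (dot terms - c) := of_decide_eq_true h
  have key := lb_le_eval h0 h1 h2 (dot terms - c)
  rw [eval_sub, eval_dot] at key
  have : (0 : ℝ) ≤ lb lo hi (dot terms - c) := by exact_mod_cast hb
  linarith

/-! ### The number `t = √(2 + √2)` -/

/-- `t⁴ = 4t² − 2` for `t = √(2+√2)`. -/
theorem sqrt_two_add_sqrt_two_pow_four : Real.sqrt (2 + Real.sqrt 2) ^ 4 = 4 * Real.sqrt (2 + Real.sqrt 2) ^ 2 - 2 := by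
  have h2 : Real.sqrt 2 ^ 2 = 2 := Real.sq_sqrt (by norm_num)
  have hpos : 0 ≤ 2 + Real.sqrt 2 := by positivity
  have ht : Real.sqrt (2 + Real.sqrt 2) ^ 2 = 2 + Real.sqrt 2 := Real.sq_sqrt hpos
  have : Real.sqrt (2 + Real.sqrt 2) ^ 4 = (Real.sqrt (2 + Real.sqrt 2) ^ 2) ^ 2 := by ring
  rw [this, ht]
  nlinarith [h2]

/-- Rational bounds: `1.847759065022 ≤ √(2+√2) ≤ 1.847759065023`. -/
theorem tau_bounds : ((1847759065022 / 1000000000000 : ℚ) : ℝ) ≤ Real.sqrt (2 + Real.sqrt 2) ∧ Real.sqrt (2 + Real.sqrt 2) ≤ ((1847759065023 / 1000000000000 : ℚ) : ℝ) := by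
  have hs2lo : (14142135623730 / 10000000000000 : ℝ) ≤ Real.sqrt 2 := by
    rw [Real.le_sqrt (by norm_num) (by norm_num)]; norm_num
  have hs2hi : Real.sqrt 2 ≤ (14142135623731 / 10000000000000 : ℝ) := by
    rw [Real.sqrt_le_left (by norm_num)]; norm_num
  constructor
  · push_cast
    rw [Real.le_sqrt (by norm_num) (by positivity)]
    nlinarith [hs2lo]
  · push_cast
    rw [Real.sqrt_le_left (by norm_num)]
    nlinarith [hs2hi]

/-- Self-test of the kernel evaluation path used for the certificate (`decide +kernel`, standard axioms):
`(t/2)·(t/2) − (1/2 + (t² − 2)/4) = 0` has certified lower bound `≥ 0` on the enclosure of `t`… here simply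
a two-term column whose reduced cost is `t² / 4 − 1/2 ≥ 0`. -/
example : colOK (1847759065022 / 1000000000000) (1847759065023 / 1000000000000)
    [((1 : ℚ), ⟨0, 0, 1/4, 0⟩)] ⟨1/2, 0, 0, 0⟩ = true := by
  decide +kernel

end QT
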